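import Literature.Analysis.FluidPDE.FluidComputer.ThresholdLevelTableA5
import HarnessLib

/-!
# Kernel run of the A = 5 level-table checker, chunks 60 … 63 (steps 1500 … 1599) (bp3 gen 13, layer 4)

HONEST FRAMING: low prior, high value-of-information experiment on Tao's machine paradigm; NOT a
claim that NS blows up.

Four kernel evaluations (`decide +kernel`; no `native_decide`, no extra axioms) of the checker
`runSteps` (`ThresholdLevelCheck.lean`) on 25 steps of `ThresholdLevelTableA5.stepsT` at a time, from
the entry box `Bc i` towards the next chunk's first level, returning the entry box `Bc (i+1)`
(≈ 30 s of kernel time per chunk; same scheme as `ThresholdLevelTableRun0 … 7` for A = 2).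
-/

namespace Literature.Analysis.FluidPDE.FluidComputer

namespace ThresholdLevelTableA5

set_option maxHeartbeats 10000000 in
set_option maxRecDepth 200000 in
/-- Chunk 60 of the A = 5 table run (steps 1500 … 1524). [folklore] -/
theorem run60 : runSteps 60 12 3 GIt RbIt Bc60 chunk60 46798196909749088 = some Bc61 := by
  decide +kernel

set_option maxHeartbeats 10000000 in
set_option maxRecDepth 200000 in
/-- Chunk 61 of the A = 5 table run (steps 1525 … 1549). [folklore] -/
theorem run61 : runSteps 60 12 3 GIt RbIt Bc61 chunk61 51226904652524232 = some Bc62 := by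
  decide +kernel

set_option maxHeartbeats 10000000 in
set_option maxRecDepth 200000 in
/-- Chunk 62 of the A = 5 table run (steps 1550 … 1574). [folklore] -/
theorem run62 : runSteps 60 12 3 GIt RbIt Bc62 chunk62 56074719402963432 = some Bc63 := by
  decide +kernel

set_option maxHeartbeats 10000000 in
set_option maxRecDepth 200000 in
/-- Chunk 63 of the A = 5 table run (steps 1575 … 1599). [folklore] -/
theorem run63 : runSteps 60 12 3 GIt RbIt Bc63 chunk63 61381302997899344 = some Bc64 := by
  decide +kernel

end ThresholdLevelTableA5

end Literature.Analysis.FluidPDE.FluidComputer
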